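import Summits.HubbardSuperconductivity.HubbardSuperconductivity.Theorems.AnisotropyChordTransferFibre3FinX3Eval

/-!
# Route `AnisotropyChord` / H0 rotor rung: FIN per-`L` GM₃ (X5), `L = 33` — rows `N₁` / D / side-condition cell facts, part `p09`

Kernel facts (`decide +kernel`) for cert cells 38, 39 of the per-`L` grid of `L = 33`: `xbnCellAny2` (row `N₁` on XB2 point wedges recomputed in the kernel, exporting the literal brackets `nt ⊇ T⁺ − 3λ₂` and `tb ⊇ T⁺·D`), `xdCellAnyN0` (row D, reads `nt`), `sdCellAnyZN` (side condition, reads `nt`); evaluators `…FinX3Eval` / `…FinX5Eval`; constants from the compiled design probe (x3probe/x3plan, margins c ×0.985, b ×1.03, aD ×1.03); assembled in `…FinX5GM3ThirtyThree`.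
Prover seat `hubbard-h0-rotor-p3` g8; helper for piece A = stmt-HubbardSuperconductivity-23918 of rung 19089 (`--supports`, helper class).
WHAT THIS IS NOT: nothing here proves superconductivity in the Hubbard model (rotor TARGET as worded stays FALSE, g15 verdict); kernel facts for the FIN certificate of ONE conditional reduction.  Tree imports only; zero data; standard axioms.
-/

set_option linter.dupNamespace false
set_option autoImplicit false

namespace Summit.HubbardSuperconductivity.HubbardSuperconductivity.Theorems.AnisotropyChord.Transfer.Fibre3

namespace FinXD

open FinXB FinCell Hole2

set_option maxHeartbeats 4000000 in
/-- row `N₁` of cell 38 of `L = 33` (`c = 61/100`), exporting `nt`, `tb`. [folklore] -/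
theorem xn33_38 : xbnCellAny2 33 (49/50 : ℚ) 122358273608453 125417230448664 (61/100 : ℚ) ((-1373220129803 : ℤ), (1416329980686 : ℤ)) ((365699360248652 : ℤ), (377670261773582 : ℤ)) = true := by decide +kernel

set_option maxHeartbeats 4000000 in
/-- row D of cell 38 of `L = 33` (`aD = 43/500`). [folklore] -/
theorem xd33_38 : xdCellAnyN0 33 (49/50 : ℚ) 122358273608453 125417230448664 (43/500 : ℚ) ((-1373220129803 : ℤ), (1416329980686 : ℤ)) = true := by decide +kernel

set_option maxHeartbeats 4000000 in
/-- side condition of cell 38 of `L = 33` (`c, b = 55/100, aD`). [folklore] -/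
theorem sd33_38 : sdCellAnyZN 33 (49/50 : ℚ) 100 122358273608453 125417230448664 ((61/100 : ℚ), (55 : ℕ), (43/500 : ℚ)) ((-1373220129803 : ℤ), (1416329980686 : ℤ)) = true := by decide +kernel

set_option maxHeartbeats 4000000 in
/-- row `N₁` of cell 39 of `L = 33` (`c = 61/100`), exporting `nt`, `tb`. [folklore] -/
theorem xn33_39 : xbnCellAny2 33 (49/50 : ℚ) 125417230448664 128552661209882 (61/100 : ℚ) ((-1365531396835 : ℤ), (1417072486427 : ℤ)) ((374883863491080 : ℤ), (387077352574150 : ℤ)) = true := by decide +kernel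

set_option maxHeartbeats 4000000 in
/-- row D of cell 39 of `L = 33` (`aD = 43/500`). [folklore] -/
theorem xd33_39 : xdCellAnyN0 33 (49/50 : ℚ) 125417230448664 128552661209882 (43/500 : ℚ) ((-1365531396835 : ℤ), (1417072486427 : ℤ)) = true := by decide +kernel

set_option maxHeartbeats 4000000 in
/-- side condition of cell 39 of `L = 33` (`c, b = 55/100, aD`). [folklore] -/
theorem sd33_39 : sdCellAnyZN 33 (49/50 : ℚ) 100 125417230448664 128552661209882 ((61/100 : ℚ), (55 : ℕ), (43/500 : ℚ)) ((-1365531396835 : ℤ), (1417072486427 : ℤ)) = true := by decide +kernel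

end FinXD

end Summit.HubbardSuperconductivity.HubbardSuperconductivity.Theorems.AnisotropyChord.Transfer.Fibre3
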